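import Summits.ResolutionOfSingularities.ResolutionOfSingularities.Theorems.MarkedTransferCampaignW46WWalkNRBaseChange
import HarnessLib

/-!
# [OURS · L1 W4.6 rung (iii-2), NON-RATIONAL W-WALK, brick 1b] THE UNIT TWIST: `stepT` commutes with multiplying the generator
# `z^p + f` by a unit, and a unit in `t` alone is fixed by the step

Cell `res-hironaka`, LADDER-RESOLUTION rung L (D-0089), slot W4.6 rung (iii); seat res-L1-s46-pv-6 (gen 8). Host route MarkedTransfer,
`--supports stmt-ResolutionOfSingularities-16155 --as helper`; kind proof (no definition). On the `σ = p` PLATEAU of the non-rational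
W-walk a DEFECT state (degree-`d` form `c₀ t^r z^p`, i.e. the anchor does not realise the residual order) is repaired by the SHADOW anchor
`(z^p + f) · (1 + c₀ t^r)⁻¹`; this file shows the shadow is again a W-walk with the SAME step data:
* `stepT_twist` — `z^p + stepT p l γ ((z^p + f)·v − z^p) = (z^p + stepT p l γ f) · v(stepS l γ)` for EVERY series `v` (pv-5's
  `subst_stepS_generator` on both sides, multiplicativity of `subst`, cancellation of `t^p`);
* `subst_stepS_C_add_C_mul_X_pow` — `C a + C b·t^r` is fixed by `stepS` (`t ↦ t`); `isUnit_one_add_C_mul_X_pow`, `map_one_add_C_mul_X_pow`;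
* `lowVanish_mul_right`, `bdiv_mul_right`, `lowVanish_twist`, `X_t_ne_zero`.

HONEST FRAMING. OURS; nothing here is a statement of H. Hironaka's manuscript [Hironaka2017] and nothing of it is used. AI-written;
AI review is weaker than expert review. No `sorry`; axioms standard. [cite: Hauser2010, §§F–G] for the chart/cleaning calculus; [folklore].
-/

noncomputable section

set_option linter.dupNamespace false -- mandated namespace of this single-conjunct summit

open MvPowerSeries Finset

namespace Summit.ResolutionOfSingularities.ResolutionOfSingularities.Theorems

namespace CampaignW46

namespace WWalkNR

open WWalk

/-! ## §4 The unit twist -/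

section Twist

variable {K : Type*} [Field K]

/-- `LowVanish` is stable under multiplication on the right. [folklore] -/
theorem lowVanish_mul_right {n : ℕ} {f : MvPowerSeries (Option (Fin 2)) K} (hf : LowVanish n f) (v : MvPowerSeries (Option (Fin 2)) K) :
    LowVanish n (f * v) := by
  intro e he
  rw [MvPowerSeries.coeff_mul]
  refine sum_eq_zero fun x hx => ?_
  rw [Finset.HasAntidiagonal.mem_antidiagonal] at hx
  have h1 : x.1.degree ≤ e.degree := by rw [← hx, map_add]; exact Nat.le_add_right _ _
  rw [hf x.1 (lt_of_le_of_lt h1 he), zero_mul]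

/-- `BDiv` is stable under multiplication on the right. [folklore] -/
theorem bdiv_mul_right {rt ry : ℕ} {f : MvPowerSeries (Option (Fin 2)) K} (hf : BDiv rt ry f) (v : MvPowerSeries (Option (Fin 2)) K) :
    BDiv rt ry (f * v) := by
  classical
  intro e he
  rw [MvPowerSeries.coeff_mul] at he
  obtain ⟨x, hx, hne⟩ := exists_ne_zero_of_sum_ne_zero he
  rw [Finset.HasAntidiagonal.mem_antidiagonal] at hx
  have h1 : coeff x.1 f ≠ 0 := fun h0 => hne (by rw [h0, zero_mul])
  have h2 := hf x.1 h1
  have h3 : x.1 (some 0) ≤ e (some 0) := by rw [← hx]; exact Nat.le_add_right _ _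
  have h4 : x.1 (some 1) ≤ e (some 1) := by rw [← hx]; exact Nat.le_add_right _ _
  exact ⟨h2.1.trans h3, h2.2.trans h4⟩

/-- The variable `t` is not zero. [folklore] -/
theorem X_t_ne_zero : (X (some 0) : MvPowerSeries (Option (Fin 2)) K) ≠ 0 := by
  intro h
  have h1 := congrArg (coeff (Finsupp.single (some (0 : Fin 2)) 1)) h
  rw [coeff_X, if_pos rfl, map_zero] at h1
  exact one_ne_zero h1

/-- `z^p` has no monomial of degree `< p`. [folklore] -/
theorem lowVanish_X_pow (p : ℕ) : LowVanish p (X none ^ p : MvPowerSeries (Option (Fin 2)) K) := by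
  intro e he
  rw [X_pow_eq, coeff_monomial, if_neg]
  intro h
  rw [h, Finsupp.degree_single] at he
  exact lt_irrefl _ he

/-- The twisted residual `(z^p + f)·v − z^p` has order `≥ p` when `f` has. [folklore] -/
theorem lowVanish_twist {p : ℕ} {f : MvPowerSeries (Option (Fin 2)) K} (hf : LowVanish p f) (v : MvPowerSeries (Option (Fin 2)) K) :
    LowVanish p ((X none ^ p + f) * v - X none ^ p) := by
  intro e he
  rw [map_sub, lowVanish_mul_right (fun e' he' => by rw [map_add, lowVanish_X_pow p e' he', hf e' he', add_zero]) v e he,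
    lowVanish_X_pow p e he, sub_zero]

/-- **THE UNIT TWIST COMMUTES WITH THE STEP**: `z^p + stepT p l γ ((z^p + f)·v − z^p) = (z^p + stepT p l γ f) · v(stepS l γ)` for every
series `v` (pv-5's `subst_stepS_generator` on both sides; `subst` is multiplicative; cancel `t^p`). [cite: Hauser2010, §§F–G] -/
theorem stepT_twist {p : ℕ} [Fact p.Prime] [CharP K p] (l γ : K) {f : MvPowerSeries (Option (Fin 2)) K} (hf : LowVanish p f)
    (v : MvPowerSeries (Option (Fin 2)) K) :
    X none ^ p + stepT p l γ ((X none ^ p + f) * v - X none ^ p) = (X none ^ p + stepT p l γ f) * subst (stepS l γ) v := by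
  have h1 := subst_stepS_generator l γ (lowVanish_twist hf v)
  rw [add_sub_cancel, subst_mul (hasSubst_stepS l γ), subst_stepS_generator l γ hf, mul_assoc] at h1
  exact (mul_left_cancel₀ (pow_ne_zero p X_t_ne_zero) h1).symm

/-- **A unit in `t` alone is fixed by the step substitution**: `subst (stepS l γ) (C a + C b · t^r) = C a + C b · t^r`. [folklore] -/
theorem subst_stepS_C_add_C_mul_X_pow (l γ a b : K) (r : ℕ) :
    subst (stepS l γ) (MvPowerSeries.C a + MvPowerSeries.C b * X (some 0) ^ r : MvPowerSeries (Option (Fin 2)) K) =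
      MvPowerSeries.C a + MvPowerSeries.C b * X (some 0) ^ r := by
  rw [subst_add (hasSubst_stepS l γ), subst_mul (hasSubst_stepS l γ), subst_pow (hasSubst_stepS l γ), subst_C, subst_C,
    subst_X (hasSubst_stepS l γ), stepS_zero]

/-- A series of the form `C 1 + C b · t^r`, `r ≥ 1`, is a unit. [folklore] -/
theorem isUnit_one_add_C_mul_X_pow (b : K) {r : ℕ} (hr : 1 ≤ r) :
    IsUnit (MvPowerSeries.C (1 : K) + MvPowerSeries.C b * X (some 0) ^ r : MvPowerSeries (Option (Fin 2)) K) := by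
  refine MvPowerSeries.isUnit_iff_constantCoeff.mpr ?_
  rw [map_add, map_mul, map_pow, MvPowerSeries.constantCoeff_C, MvPowerSeries.constantCoeff_C, MvPowerSeries.constantCoeff_X,
    zero_pow (by omega), mul_zero, add_zero]
  exact isUnit_one

/-- The coefficient map of the `t`-unit. [folklore] -/
theorem map_one_add_C_mul_X_pow {K' : Type*} [Field K'] (ι : K →+* K') (b : K) (r : ℕ) :
    MvPowerSeries.map ι (MvPowerSeries.C (1 : K) + MvPowerSeries.C b * X (some 0) ^ r : MvPowerSeries (Option (Fin 2)) K) =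
      MvPowerSeries.C (1 : K') + MvPowerSeries.C (ι b) * X (some 0) ^ r := by
  rw [map_add, map_mul, map_pow, MvPowerSeries.map_C, MvPowerSeries.map_C, MvPowerSeries.map_X, map_one]

end Twist

end WWalkNR

end CampaignW46

end Summit.ResolutionOfSingularities.ResolutionOfSingularities.Theorems

end
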